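import Literature.NumberTheory.Automorphic.UnitaryThreeFixedPointsCount                       -- ★ (F3c-C9-inst) B-p04
import Literature.NumberTheory.Automorphic.UnitaryThreeRamifiedTorusDoubleCosetsHK             -- ★ γ2′ B-p12: `hA′`
import Literature.NumberTheory.Automorphic.UnitaryThreeRamifiedTorusDoubleCosetsHKDisjoint     -- ★ γ2′ B-p12: `hB′`
import Literature.NumberTheory.Automorphic.UnitaryThreeRamifiedTorusDoubleCosetsHKWeight       -- ★ γ2′ B-p12: weight′ (ED. 2)
import Literature.NumberTheory.Automorphic.UnitaryThreeRamifiedTorusMars                       -- ★ γ2′ B-p12: `hMars` in K (ED. 3)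
import HarnessLib

/-!
# Flicker's Cor. 9 ASSEMBLED at the RAMIFIED (type-(2)) torus: `#{z ∈ H ⧸ H^K_m : t′·z = z} = Σᶠₙ qⁿ · #{w ∈ P_H ⧸ (P_H ∩ H^K_m) : w̃⁻¹ (rₙ⁻¹ t′ rₙ) w̃ ∈ H^K_m}`
(Flicker, *Elementary proof of the fundamental lemma for a unitary group* (1998), Cor. 9 p. 85 with Prop. 6 (second half) p. 83 and Prop. 8 p. 84)

Topic `NumberTheory/Automorphic`; namespace `Literature.NumberTheory.Automorphic.UnitaryGroup`.  THEOREMS ONLY (no `def`, no instance, no notation, no named fact,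
no `sorry`; one `synthInstance.maxHeartbeats` bump).  Cell `pub/hodgecm-mathlib`, F0∕P3a road «N7-ns COUNT FROM FLICKER» (MAP v3, architect A-p06 (g26)), brick
**(F3c-C9-θ′)** (B-p04 (g33), claim 06:15:36Z ✓ LEAD T8-92 (4)): the TYPE-(2) twin of ★ (F3c-C9-θ) p841650 — ★ (F3c-C9-inst) `natCard_fixedPoints_centralizer_eq_finsum`
(p841447) with `hA` ∕ `hB` DISCHARGED by ★ B-p12 (g28)'s γ2′ `exists_mem_centralizer_mul_ramifiedRep_mul_mem_flickerKH` (p841830) ∕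
`eq_of_centralizer_mul_ramifiedRep_mul_flickerKH_eq` (p841677) in their binder alphabet VERBATIM (abstract bridge `(R, ι, σR, dR)`, `[IsAdicComplete 𝔪_R R]`, the
K-side Mars binder `hMars` = ★ γ1′ p841622 read in `K` (named residual «adjoin-root adapter»), the two-family representatives `r (2a) = diag(ϖ^{−a},1,ϖ^{a})`,
`r (2a+1) = !![0,0,ϖ^{a+1}∕d; 0,1,0; −d ϖ^{−(a+1)},0,0]`), and the weight as the binder `hweight : [T′ : T′ ∩ rₙ K_H rₙ⁻¹] = qⁿ` (B-p12's γ2′ weight′, Flicker Prop. 6 (c) ∕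
Prop. 7: `[R_L^× : R_L(n)^×] = qⁿ`, ★ (F3b)).  The right side is EXACTLY the binder `hC9` of ★ A-p03 `natCard_fixedPoints_unitaryInt_ramifiedTorus_eq_phiTHM` (p841800):
inner sets in the `U`-level coset currency with the conjugate spelled `(↑(r n))⁻¹ * ↑t′ * ↑(r n)`.  HC_CM is proved only modulo the printed citations until rung 0
closes; structure theory for ONE clause of #103-ns, pays nothing by itself.

* `v_map_eq_one_of_isUnit` — `|ι d| = 1` for a unit `d` of `R` (the `hvd` of `hB′` from `hdRu`).
* **`natCard_fixedPoints_ramifiedTorus_eq_finsum … (hweight) (hfin) : Nat.card {x // ⟨t′,htH⟩ • x = x} = ∑ᶠ n, q ^ n * Nat.card {w // (out w)⁻¹ * ((↑(r n))⁻¹ * ↑t′ * ↑(r n)) * out w ∈ flickerHK σ J c um}`**.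

## References
* [Flicker1998UnitaryFL] Y. Z. Flicker, *Elementary proof of the fundamental lemma for a unitary group*, Canad. J. Math. 50 (1998), Prop. 6 p. 83, Prop. 7 p. 84, Prop. 8 p. 84,
  Cor. 9 p. 85.
-/

open scoped MatrixGroups WithZero
open Matrix

namespace Literature.NumberTheory.Automorphic

namespace UnitaryGroup

open Literature.NumberTheory.Automorphic.HermitianLattice (unitaryInt mem_unitaryInt_iff LocalConjDatum)
open IsLocalRing

universe u

section Ramified

variable {K : Type*} [Field K] [Valued K ℤᵐ⁰] {ϖ : K} (σ : K →+* K) {J : Matrix (Fin 3) (Fin 3) K}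

/-- A unit of `R` has valuation `1` in `K` under an integral bridge `ι : R → K` (`|ι x| ≤ 1` for all `x`). [cite: Flicker1998UnitaryFL, Prop. 6 p. 83] -/
theorem v_map_eq_one_of_isUnit {R : Type u} [CommRing R] (ι : R →+* K) (hιv : ∀ x : K, Valued.v x ≤ 1 ↔ x ∈ Set.range ι)
    {d : R} (hd : IsUnit d) : Valued.v (ι d) = 1 := by
  obtain ⟨e, he⟩ := hd.exists_right_inv
  have h1 : Valued.v (ι d) * Valued.v (ι e) = 1 := by rw [← map_mul, ← map_mul, he, map_one, map_one]
  have hdle : Valued.v (ι d) ≤ 1 := (hιv _).2 ⟨d, rfl⟩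
  have hele : Valued.v (ι e) ≤ 1 := (hιv _).2 ⟨e, rfl⟩
  refine le_antisymm hdle ?_
  calc (1 : ℤᵐ⁰) = Valued.v (ι d) * Valued.v (ι e) := h1.symm
    _ ≤ Valued.v (ι d) * 1 := mul_le_mul' le_rfl hele
    _ = Valued.v (ι d) := mul_one _

set_option synthInstance.maxHeartbeats 120000 in
/-- **FLICKER'S COR. 9 AT THE RAMIFIED (TYPE-(2)) TORUS, ASSEMBLED** — ★ (F3c-C9-inst) `natCard_fixedPoints_centralizer_eq_finsum` (p841447) with `hA` ∕ `hB`
DISCHARGED by ★ B-p12 (g28)'s γ2′ `exists_mem_centralizer_mul_ramifiedRep_mul_mem_flickerKH` ∕ `eq_of_centralizer_mul_ramifiedRep_mul_flickerKH_eq` (their binder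
alphabet VERBATIM: torus block `t′ = !![A,0,B;0,b₀,0;C,0,A]`, `B = Cρ`, `|ρ| = |ϖ|`, the two-family representatives `r (2a)`, `r (2a+1)`, the K-side Mars binder
`hMars`), and the weight entered as the binder `hweight : [T′ : T′ ∩ rₙ K_H rₙ⁻¹] = qⁿ` (B-p12's γ2′ weight′, Flicker Prop. 6 (c) second half, Prop. 7: `[R_L^× : R_L(n)^×] = qⁿ`
— ★ (F3b)).  The inner sets are in the `U`-level coset currency of ★ A-p03 `natCard_cosets_ramifiedTorus_even∕odd_eq_iTen` (p841759) and the whole right side is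
the binder `hC9` of ★ A-p03 `natCard_fixedPoints_unitaryInt_ramifiedTorus_eq_phiTHM` (p841800).
[cite: Flicker1998UnitaryFL, Cor. 9 p. 85; Prop. 6 p. 83; Prop. 8 p. 84] -/
theorem natCard_fixedPoints_ramifiedTorus_eq_finsum (hJ : J = (StdForm.antidiagonal 3).over K) (hd : LocalConjDatum σ ϖ) {y : K}
    (hy : y * σ y = -2) (m : ℕ) {um : ↥(unitaryGroupOfForm σ J)}
    (hum : ((um : GL (Fin 3) K) : Matrix (Fin 3) (Fin 3) K) = !![ϖ ^ m, y, (ϖ ^ m)⁻¹; 0, 1, -σ y * (ϖ ^ m)⁻¹; 0, 0, (ϖ ^ m)⁻¹])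
    {R : Type u} [CommRing R] [IsDomain R] [IsDiscreteValuationRing R] [IsAdicComplete (IsLocalRing.maximalIdeal R) R]
    (ι : R →+* K) (hι : Function.Injective ι)
    (hιv : ∀ x : K, Valued.v x ≤ 1 ↔ x ∈ Set.range ι) (σR : R →+* R) (hσR : ∀ r, σR (σR r) = r) (hσι : ∀ r, ι (σR r) = σ (ι r))
    {dR : R} (hdRσ : σR dR = -dR) (hdRu : IsUnit dR) (h2R : IsUnit (2 : R))
    {c : ↥(unitaryGroupOfForm σ J)} (hc : ((c : GL (Fin 3) K) : Matrix (Fin 3) (Fin 3) K) = !![1, 0, 0; 0, -1, 0; 0, 0, 1])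
    {ρ π₀ : K} (hρ : Valued.v ρ = Valued.v ϖ) (hπ₀ : π₀ = ι dR ^ 2 * ρ)
    (hMars : ∀ G : Matrix (Fin 2) (Fin 2) K, (∀ a b, σ (G a b) = G a b) → (∀ a b, Valued.v (G a b) ≤ 1) →
      G 0 0 * G 1 1 - G 0 1 * G 1 0 ≠ 0 →
      ∃ (u v : K) (i : ℕ) (U₀ U₁ W₀ W₁ : K), σ u = u ∧ σ v = v ∧
        Valued.v U₀ ≤ 1 ∧ Valued.v U₁ ≤ 1 ∧ Valued.v W₀ ≤ 1 ∧ Valued.v W₁ ≤ 1 ∧ Valued.v (U₀ * W₁ - U₁ * W₀) = 1 ∧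
        G 0 0 = u * U₀ + π₀ * v * (π₀ ^ i * W₀) ∧ G 1 0 = v * U₀ + u * (π₀ ^ i * W₀) ∧
        G 0 1 = u * U₁ + π₀ * v * (π₀ ^ i * W₁) ∧ G 1 1 = v * U₁ + u * (π₀ ^ i * W₁))
    {t : ↥(unitaryGroupOfForm σ J)} (htH : t ∈ Subgroup.centralizer ({c} : Set ↥(unitaryGroupOfForm σ J))) {A B C b₀ : K}
    (hte : ((t : GL (Fin 3) K) : Matrix (Fin 3) (Fin 3) K) = !![A, 0, B; 0, b₀, 0; C, 0, A]) (hC : C ≠ 0) (hBC : B = C * ρ)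
    (r : ℕ → ↥(Subgroup.centralizer ({c} : Set ↥(unitaryGroupOfForm σ J))))
    (hr0 : ∀ a : ℕ, (((r (2 * a) : ↥(unitaryGroupOfForm σ J)) : GL (Fin 3) K) : Matrix (Fin 3) (Fin 3) K) =
      !![(ϖ ^ a)⁻¹, 0, 0; 0, 1, 0; 0, 0, ϖ ^ a])
    (hr1 : ∀ a : ℕ, (((r (2 * a + 1) : ↥(unitaryGroupOfForm σ J)) : GL (Fin 3) K) : Matrix (Fin 3) (Fin 3) K) =
      !![0, 0, ϖ ^ (a + 1) / ι dR; 0, 1, 0; -ι dR * (ϖ ^ (a + 1))⁻¹, 0, 0])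
    {q : ℕ}
    (hweight : ∀ n : ℕ, ((((flickerKH σ J c).subgroupOf (Subgroup.centralizer ({c} : Set ↥(unitaryGroupOfForm σ J)))).map
        (MulAut.conj (r n)).toMonoidHom).relIndex
        (Subgroup.centralizer ({⟨t, htH⟩} : Set ↥(Subgroup.centralizer ({c} : Set ↥(unitaryGroupOfForm σ J)))))) = q ^ n)
    (hfin : {x : ↥(Subgroup.centralizer ({c} : Set ↥(unitaryGroupOfForm σ J))) ⧸
        (flickerHK σ J c um).subgroupOf (Subgroup.centralizer ({c} : Set ↥(unitaryGroupOfForm σ J))) |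
      (⟨t, htH⟩ : ↥(Subgroup.centralizer ({c} : Set ↥(unitaryGroupOfForm σ J)))) • x = x}.Finite) :
    Nat.card {x : ↥(Subgroup.centralizer ({c} : Set ↥(unitaryGroupOfForm σ J))) ⧸
        (flickerHK σ J c um).subgroupOf (Subgroup.centralizer ({c} : Set ↥(unitaryGroupOfForm σ J))) //
        (⟨t, htH⟩ : ↥(Subgroup.centralizer ({c} : Set ↥(unitaryGroupOfForm σ J)))) • x = x} =
      ∑ᶠ n : ℕ, q ^ n *
        Nat.card {w : ↥(flickerPH σ J c) ⧸ (flickerHK σ J c um).subgroupOf (flickerPH σ J c) //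
          ((Quotient.out w : ↥(flickerPH σ J c)) : ↥(unitaryGroupOfForm σ J))⁻¹ *
              ((((r n : ↥(Subgroup.centralizer ({c} : Set ↥(unitaryGroupOfForm σ J)))) : ↥(unitaryGroupOfForm σ J)))⁻¹ *
                (t : ↥(unitaryGroupOfForm σ J)) * ((r n : ↥(Subgroup.centralizer ({c} : Set ↥(unitaryGroupOfForm σ J)))) : ↥(unitaryGroupOfForm σ J))) *
            (Quotient.out w : ↥(flickerPH σ J c)) ∈ flickerHK σ J c um} := by
  have hvd : Valued.v (ι dR) = 1 := v_map_eq_one_of_isUnit ι hιv hdRu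
  have ht' : ∀ τ ∈ Subgroup.centralizer ({⟨t, htH⟩} : Set ↥(Subgroup.centralizer ({c} : Set ↥(unitaryGroupOfForm σ J)))),
      τ * ⟨t, htH⟩ = ⟨t, htH⟩ * τ := fun τ hτ => Subgroup.mem_centralizer_singleton_iff.1 hτ
  rw [natCard_fixedPoints_centralizer_eq_finsum σ hJ hd hy m hum hc r ⟨t, htH⟩ _ ht'
    (exists_mem_centralizer_mul_ramifiedRep_mul_mem_flickerKH σ hJ hd ι hι hιv σR hσR hσι hdRσ hdRu h2R hc hρ hπ₀ hMars htH hte hC hBC r hr0 hr1)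
    (eq_of_centralizer_mul_ramifiedRep_mul_flickerKH_eq σ hJ hd hc hvd hρ htH hte hC hBC r hr0 hr1) hfin]
  refine finsum_congr fun n => ?_
  rw [hweight n]
  rfl

/-! ## ED. 2 — the weight binder discharged by ★ B-p12's weight′ -/

set_option synthInstance.maxHeartbeats 120000 in
/-- **FLICKER'S COR. 9 AT THE RAMIFIED TORUS, WEIGHT DISCHARGED** (ED. 2): `natCard_fixedPoints_ramifiedTorus_eq_finsum` with `hweight := ★ B-p12`
`relIndex_flickerKH_conj_ramifiedRep_eq` (p841900: `[T′ : T′ ∩ rₙ K_H rₙ⁻¹] = q₀ⁿ`, `#k_R = q₀²`). Only `hMars` (K-side Mars) and `hfin` remain as named binders.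
[cite: Flicker1998UnitaryFL, Cor. 9 p. 85; Prop. 6 p. 83; Prop. 7 p. 84; Prop. 8 p. 84] -/
theorem natCard_fixedPoints_ramifiedTorus_eq_finsum' (hJ : J = (StdForm.antidiagonal 3).over K) (hd : LocalConjDatum σ ϖ) {y : K}
    (hy : y * σ y = -2) (m : ℕ) {um : ↥(unitaryGroupOfForm σ J)}
    (hum : ((um : GL (Fin 3) K) : Matrix (Fin 3) (Fin 3) K) = !![ϖ ^ m, y, (ϖ ^ m)⁻¹; 0, 1, -σ y * (ϖ ^ m)⁻¹; 0, 0, (ϖ ^ m)⁻¹])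
    {R : Type u} [CommRing R] [IsDomain R] [IsDiscreteValuationRing R] [IsAdicComplete (IsLocalRing.maximalIdeal R) R]
    (ι : R →+* K) (hι : Function.Injective ι)
    (hιv : ∀ x : K, Valued.v x ≤ 1 ↔ x ∈ Set.range ι) (σR : R →+* R) (hσR : ∀ r, σR (σR r) = r) (hσι : ∀ r, ι (σR r) = σ (ι r))
    {dR : R} (hdRσ : σR dR = -dR) (hdRu : IsUnit dR) (h2R : IsUnit (2 : R)) {ϖR : R} (hϖR : Irreducible ϖR) (hιϖ : ι ϖR = ϖ)
    {q₀ : ℕ} (hq : Nat.card (ResidueField R) = q₀ ^ 2)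
    {c : ↥(unitaryGroupOfForm σ J)} (hc : ((c : GL (Fin 3) K) : Matrix (Fin 3) (Fin 3) K) = !![1, 0, 0; 0, -1, 0; 0, 0, 1])
    {ρ π₀ : K} (hρ : Valued.v ρ = Valued.v ϖ) (hπ₀ : π₀ = ι dR ^ 2 * ρ)
    (hMars : ∀ G : Matrix (Fin 2) (Fin 2) K, (∀ a b, σ (G a b) = G a b) → (∀ a b, Valued.v (G a b) ≤ 1) →
      G 0 0 * G 1 1 - G 0 1 * G 1 0 ≠ 0 →
      ∃ (u v : K) (i : ℕ) (U₀ U₁ W₀ W₁ : K), σ u = u ∧ σ v = v ∧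
        Valued.v U₀ ≤ 1 ∧ Valued.v U₁ ≤ 1 ∧ Valued.v W₀ ≤ 1 ∧ Valued.v W₁ ≤ 1 ∧ Valued.v (U₀ * W₁ - U₁ * W₀) = 1 ∧
        G 0 0 = u * U₀ + π₀ * v * (π₀ ^ i * W₀) ∧ G 1 0 = v * U₀ + u * (π₀ ^ i * W₀) ∧
        G 0 1 = u * U₁ + π₀ * v * (π₀ ^ i * W₁) ∧ G 1 1 = v * U₁ + u * (π₀ ^ i * W₁))
    {t : ↥(unitaryGroupOfForm σ J)} (htH : t ∈ Subgroup.centralizer ({c} : Set ↥(unitaryGroupOfForm σ J))) {A B C b₀ : K}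
    (hte : ((t : GL (Fin 3) K) : Matrix (Fin 3) (Fin 3) K) = !![A, 0, B; 0, b₀, 0; C, 0, A]) (hC : C ≠ 0) (hBC : B = C * ρ)
    (r : ℕ → ↥(Subgroup.centralizer ({c} : Set ↥(unitaryGroupOfForm σ J))))
    (hr0 : ∀ a : ℕ, (((r (2 * a) : ↥(unitaryGroupOfForm σ J)) : GL (Fin 3) K) : Matrix (Fin 3) (Fin 3) K) =
      !![(ϖ ^ a)⁻¹, 0, 0; 0, 1, 0; 0, 0, ϖ ^ a])
    (hr1 : ∀ a : ℕ, (((r (2 * a + 1) : ↥(unitaryGroupOfForm σ J)) : GL (Fin 3) K) : Matrix (Fin 3) (Fin 3) K) =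
      !![0, 0, ϖ ^ (a + 1) / ι dR; 0, 1, 0; -ι dR * (ϖ ^ (a + 1))⁻¹, 0, 0])
    (hfin : {x : ↥(Subgroup.centralizer ({c} : Set ↥(unitaryGroupOfForm σ J))) ⧸ (flickerHK σ J c um).subgroupOf (Subgroup.centralizer ({c} : Set ↥(unitaryGroupOfForm σ J))) | (⟨t, htH⟩ : ↥(Subgroup.centralizer ({c} : Set ↥(unitaryGroupOfForm σ J)))) • x = x}.Finite) :
    Nat.card {x : ↥(Subgroup.centralizer ({c} : Set ↥(unitaryGroupOfForm σ J))) ⧸ (flickerHK σ J c um).subgroupOf (Subgroup.centralizer ({c} : Set ↥(unitaryGroupOfForm σ J))) // (⟨t, htH⟩ : ↥(Subgroup.centralizer ({c} : Set ↥(unitaryGroupOfForm σ J)))) • x = x} =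
      ∑ᶠ n : ℕ, q₀ ^ n *
        Nat.card {w : ↥(flickerPH σ J c) ⧸ (flickerHK σ J c um).subgroupOf (flickerPH σ J c) //
          ((Quotient.out w : ↥(flickerPH σ J c)) : ↥(unitaryGroupOfForm σ J))⁻¹ *
              ((((r n : ↥(Subgroup.centralizer ({c} : Set ↥(unitaryGroupOfForm σ J))))) : ↥(unitaryGroupOfForm σ J))⁻¹ * (t : ↥(unitaryGroupOfForm σ J)) * ((r n : ↥(Subgroup.centralizer ({c} : Set ↥(unitaryGroupOfForm σ J)))) : ↥(unitaryGroupOfForm σ J))) *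
            (Quotient.out w : ↥(flickerPH σ J c)) ∈ flickerHK σ J c um} :=
  natCard_fixedPoints_ramifiedTorus_eq_finsum σ hJ hd hy m hum ι hι hιv σR hσR hσι hdRσ hdRu h2R hc hρ hπ₀ hMars htH hte hC hBC r hr0 hr1
    (fun n => relIndex_flickerKH_conj_ramifiedRep_eq σ hJ hd ι hι hιv σR hσR hσι hdRσ hdRu h2R hϖR hιϖ hq hc hρ htH hte hC hBC r hr0 hr1 n) hfin

/-! ## ED. 3 — the K-side Mars binder discharged by ★ B-p12's `exists_ramifiedMars_coords` -/

set_option synthInstance.maxHeartbeats 120000 in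
/-- **FLICKER'S COR. 9 AT THE RAMIFIED TORUS, BINDER-FREE beyond frame ∕ bridge ∕ `hfin`** (ED. 3): `natCard_fixedPoints_ramifiedTorus_eq_finsum'` with `hMars :=`
★ B-p12 `exists_ramifiedMars_coords` (p841922, Mars for the ramified order `𝒪_F[√π₀]` in `K`), `|π₀| = exp(−1)` from `|ι dR| = 1`, `|ρ| = |ϖ|`.
[cite: Flicker1998UnitaryFL, Cor. 9 p. 85; Prop. 6 p. 83; Prop. 7 p. 84; Prop. 8 p. 84] -/
theorem natCard_fixedPoints_ramifiedTorus_eq_finsum'' (hJ : J = (StdForm.antidiagonal 3).over K) (hd : LocalConjDatum σ ϖ) {y : K}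
    (hy : y * σ y = -2) (m : ℕ) {um : ↥(unitaryGroupOfForm σ J)}
    (hum : ((um : GL (Fin 3) K) : Matrix (Fin 3) (Fin 3) K) = !![ϖ ^ m, y, (ϖ ^ m)⁻¹; 0, 1, -σ y * (ϖ ^ m)⁻¹; 0, 0, (ϖ ^ m)⁻¹])
    {R : Type u} [CommRing R] [IsDomain R] [IsDiscreteValuationRing R] [IsAdicComplete (IsLocalRing.maximalIdeal R) R]
    (ι : R →+* K) (hι : Function.Injective ι)
    (hιv : ∀ x : K, Valued.v x ≤ 1 ↔ x ∈ Set.range ι) (σR : R →+* R) (hσR : ∀ r, σR (σR r) = r) (hσι : ∀ r, ι (σR r) = σ (ι r))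
    {dR : R} (hdRσ : σR dR = -dR) (hdRu : IsUnit dR) (h2R : IsUnit (2 : R)) {ϖR : R} (hϖR : Irreducible ϖR) (hιϖ : ι ϖR = ϖ)
    {q₀ : ℕ} (hq : Nat.card (ResidueField R) = q₀ ^ 2)
    {c : ↥(unitaryGroupOfForm σ J)} (hc : ((c : GL (Fin 3) K) : Matrix (Fin 3) (Fin 3) K) = !![1, 0, 0; 0, -1, 0; 0, 0, 1])
    {ρ : K} (hρ : Valued.v ρ = Valued.v ϖ)
    {t : ↥(unitaryGroupOfForm σ J)} (htH : t ∈ Subgroup.centralizer ({c} : Set ↥(unitaryGroupOfForm σ J))) {A B C b₀ : K}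
    (hte : ((t : GL (Fin 3) K) : Matrix (Fin 3) (Fin 3) K) = !![A, 0, B; 0, b₀, 0; C, 0, A]) (hC : C ≠ 0) (hBC : B = C * ρ)
    (r : ℕ → ↥(Subgroup.centralizer ({c} : Set ↥(unitaryGroupOfForm σ J))))
    (hr0 : ∀ a : ℕ, (((r (2 * a) : ↥(unitaryGroupOfForm σ J)) : GL (Fin 3) K) : Matrix (Fin 3) (Fin 3) K) =
      !![(ϖ ^ a)⁻¹, 0, 0; 0, 1, 0; 0, 0, ϖ ^ a])
    (hr1 : ∀ a : ℕ, (((r (2 * a + 1) : ↥(unitaryGroupOfForm σ J)) : GL (Fin 3) K) : Matrix (Fin 3) (Fin 3) K) =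
      !![0, 0, ϖ ^ (a + 1) / ι dR; 0, 1, 0; -ι dR * (ϖ ^ (a + 1))⁻¹, 0, 0])
    (hfin : {x : ↥(Subgroup.centralizer ({c} : Set ↥(unitaryGroupOfForm σ J))) ⧸ (flickerHK σ J c um).subgroupOf (Subgroup.centralizer ({c} : Set ↥(unitaryGroupOfForm σ J))) | (⟨t, htH⟩ : ↥(Subgroup.centralizer ({c} : Set ↥(unitaryGroupOfForm σ J)))) • x = x}.Finite) :
    Nat.card {x : ↥(Subgroup.centralizer ({c} : Set ↥(unitaryGroupOfForm σ J))) ⧸ (flickerHK σ J c um).subgroupOf (Subgroup.centralizer ({c} : Set ↥(unitaryGroupOfForm σ J))) // (⟨t, htH⟩ : ↥(Subgroup.centralizer ({c} : Set ↥(unitaryGroupOfForm σ J)))) • x = x} =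
      ∑ᶠ n : ℕ, q₀ ^ n *
        Nat.card {w : ↥(flickerPH σ J c) ⧸ (flickerHK σ J c um).subgroupOf (flickerPH σ J c) //
          ((Quotient.out w : ↥(flickerPH σ J c)) : ↥(unitaryGroupOfForm σ J))⁻¹ *
              ((((r n : ↥(Subgroup.centralizer ({c} : Set ↥(unitaryGroupOfForm σ J))))) : ↥(unitaryGroupOfForm σ J))⁻¹ * (t : ↥(unitaryGroupOfForm σ J)) * ((r n : ↥(Subgroup.centralizer ({c} : Set ↥(unitaryGroupOfForm σ J)))) : ↥(unitaryGroupOfForm σ J))) *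
            (Quotient.out w : ↥(flickerPH σ J c)) ∈ flickerHK σ J c um} := by
  have hvπ₀ : Valued.v (ι dR ^ 2 * ρ) = WithZero.exp (-1 : ℤ) := by
    rw [map_mul, map_pow, v_map_eq_one_of_isUnit ι hιv hdRu, one_pow, one_mul, hρ, hd.vϖ]
  exact natCard_fixedPoints_ramifiedTorus_eq_finsum' σ hJ hd hy m hum ι hι hιv σR hσR hσι hdRσ hdRu h2R hϖR hιϖ hq hc hρ rfl
    (fun G hG _ hdet => exists_ramifiedMars_coords hvπ₀ σ G hG hdet) htH hte hC hBC r hr0 hr1 hfin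

end Ramified

end UnitaryGroup

end Literature.NumberTheory.Automorphic
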